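import Summits.BirchSwinnertonDyer.BirchSwinnertonDyer.Theorems.KolyvaginRoadThreePTCompletionSpan
import Literature.NumberTheory.GaloisRepresentations.AbsGaloisOuterConj
import Literature.NumberTheory.GaloisRepresentations.GaloisCohomologyLocalizationTransport
import Literature.NumberTheory.GaloisRepresentations.ContinuousCorestrictionDoubleCoset
import Literature.NumberTheory.GaloisRepresentations.GaloisCohomologyCorestriction
import HarnessLib

/-!
# The double-coset dictionary of the prime-to-`p` descent: `Γ_{K_v} \ Γ_K / Γ_{K'} ↔ {w ∣ v}`

Route `KolyvaginRoadThree`, crux `ZhangSharpFrameAtThreeHL` (stmt-BirchSwinnertonDyer-19574), PT road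
(C), binder (N2) `hsemi` of `middleExact_canonical_of_descentData` (p555478): the semi-local
compatibility `loc_v ∘ Cor_{K'/K} = Σ_{w ∣ v} Cor_{w/v} ∘ loc_w` is the Mackey formula
`resSubgroup_cores_eq_sum_cores_conjRes` (p552734) for `G = Γ_K`, `N = H = res(Γ_{K'})`,
`D = D_v = res(Γ_{K_v})`, once the double cosets `D_v \ Γ_K / H` are identified with the places
`w ∣ v` of `K'`.  This file proves that dictionary in the exact shape of the hypotheses of the Mackey
formula, for the representatives `g_w = τ_w⁻¹` (`τ_w = conjugator v w`, the embedding-compatible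
conjugator of `KolyvaginRoadThreePTDescentLocalData`) and `D'_w = interConj H D_v τ_w⁻¹`:
`absEmbedding_place_algebraMap` (`e_w(k') = e_v(τ_w⁻¹ • e_{K'}(k'))` for the chosen copies
`e_• = absEmbedding` of `K'`, `K'_w` in `K̄`, `K̄_v`); `mem_range_absGaloisRestrict_place_of_conj_mem`,
`mem_subgroupOf_interConj_iff`, `subgroupOf_interConj_eq_map_range`, `index_interConj_subgroupOf`
(**`D'_w = res_v(res_{w/v} Γ_{K'_w}) ≅ Γ_{K'_w}`, `[D_v : D'_w] = [K'_w : K_v]`**: an element of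
`Γ_{K_v}` whose `τ_w`-conjugate fixes `e_{K'}(K')` fixes `e_w(K')`, hence its `K_v`-span `e_w(K'_w)`,
`span_range_algebraMap_place_eq_top` of `KolyvaginRoadThreePTCompletionSpan`);
`place_eq_of_conj_mem` / `hdisj_place` (**hdisj**, rigidity `place_eq_of_algHom'` applied to
`e_{w'}⁻¹ ∘ δ ∘ e_w`);
`hcov_place` (**hcov**, by COUNTING: `(w, δ D'_w) ↦ δ τ_w⁻¹ H` is injective between finite sets of the
same size `Σ_{w∣v} [K'_w : K_v] = [K' : K] = [Γ_K : H]`).  THEOREMS only (no definition, no named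
fact, no instance); no case of BSD.

References: [CasselsFrohlichANT1967] Ch. II §10 (`L ⊗_K K_v ≅ ∏_{w∣v} L_w`; embeddings `L → K̄_v`
modulo `Γ_{K_v}` ↔ places above `v`); [NeukirchANT1999] Ch. II (8.1)–(8.4);
[NeukirchSchmidtWingberg2008] I §5 (1.5.6)–(1.5.7).
-/


noncomputable section

open Function NumberField IsDedekindDomain
open scoped NumberField Classical

set_option linter.dupNamespace false
set_option autoImplicit false

namespace Summit.BirchSwinnertonDyer.BirchSwinnertonDyer.Theorems.KolyvaginRoadThreePT

open Field
open Literature.NumberTheory.GaloisRepresentations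
open Literature.NumberTheory.GaloisRepresentations.SemiLocal (Place algebraPlace)
open Literature.NumberTheory.NumberFields
open Literature.NumberTheory.Automorphic

section Dictionary

variable {K K' : Type} [Field K] [NumberField K] [Field K'] [NumberField K'] [Algebra K K']
variable (v : HeightOneSpectrum (𝓞 K))

/-! ## The embedding dictionary `e_w(k') = e_v(τ_w⁻¹ • e_{K'} k')` -/

/-- **The embedding dictionary.**  For `k' ∈ K'`, the image of `k' ∈ K'_w` under the chosen
`K_v`-embedding `e_w : K'_w → K̄_v` is the image under `K̄ → K̄_v` of `τ_w⁻¹ • e_{K'}(k')`, where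
`e_{K'} : K' → K̄` is the chosen `K`-embedding and `τ_w` the conjugator (apply the injective
`K̄_v → \overline{K'_w}` and use `conjugator_embedding_spec`).
[cite: CasselsFrohlichANT1967, Ch. II §10] -/
theorem absEmbedding_place_algebraMap (w : Place K K' v) [Algebra.IsAlgebraic K K']
    [Algebra.IsAlgebraic (v.adicCompletion K) ((w : HeightOneSpectrum (𝓞 K')).adicCompletion K')]
    (k : K') :
    absEmbedding (v.adicCompletion K) ((w : HeightOneSpectrum (𝓞 K')).adicCompletion K')
        (algebraMap K' ((w : HeightOneSpectrum (𝓞 K')).adicCompletion K') k) =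
      absClosureEmbedding K (v.adicCompletion K) ((conjugator v w)⁻¹ • absEmbedding K K' k) := by
  have hinj : Function.Injective
      (absClosureEmbedding (v.adicCompletion K) ((w : HeightOneSpectrum (𝓞 K')).adicCompletion K')) :=
    (absClosureEmbedding (v.adicCompletion K) ((w : HeightOneSpectrum (𝓞 K')).adicCompletion K')).toRingHom.injective
  apply hinj
  rw [conjugator_embedding_spec, absClosureEmbedding_absEmbedding, absClosureEmbedding_absEmbedding,
    AlgHom.commutes]
  exact (IsScalarTower.algebraMap_apply K' ((w : HeightOneSpectrum (𝓞 K')).adicCompletion K') _ k).symm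

/-! ## `D_v ∩ τ_w⁻¹ H τ_w ⊆ res_v (res_{w/v} Γ_{K'_w})` -/

/-- **If the `τ_w`-conjugate of `res_v δ` (`δ ∈ Γ_{K_v}`) lies in `H = res(Γ_{K'})`, then
`δ ∈ res_{w/v}(Γ_{K'_w})`.**  Indeed `δ` then fixes `e_w(k')` for every `k' ∈ K'`
(`absEmbedding_place_algebraMap`); the fixed locus of `δ ∘ e_w = e_w` is a `K_v`-subspace of `K'_w`,
so it is everything (`span_range_algebraMap_place_eq_top`), i.e. `δ` fixes `e_w(K'_w)`, i.e.
`δ ∈ Γ_{K'_w}` (`mem_range_absGaloisRestrict_iff_smul_absEmbedding`).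
[cite: CasselsFrohlichANT1967, Ch. II §10] -/
theorem mem_range_absGaloisRestrict_place_of_conj_mem (w : Place K K' v)
    (δ : absoluteGaloisGroup (v.adicCompletion K))
    (h : conjugator v w * absGaloisRestrict K (v.adicCompletion K) δ * (conjugator v w)⁻¹ ∈
      (absGaloisRestrict K K').range) :
    δ ∈ (absGaloisRestrict (v.adicCompletion K) ((w : HeightOneSpectrum (𝓞 K')).adicCompletion K')).range := by
  haveI : FiniteDimensional K K' := Module.Finite.of_restrictScalars_finite ℚ K K'
  haveI := finiteDimensional_place' v w
  rw [mem_range_absGaloisRestrict_iff_smul_absEmbedding] at h ⊢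
  -- the `K_v`-subspace of `K'_w` on which `δ ∘ e_w = e_w`
  let T : Submodule (v.adicCompletion K) ((w : HeightOneSpectrum (𝓞 K')).adicCompletion K') :=
    LinearMap.eqLocus
      (((absoluteGaloisGroup.toAlgEquiv (v.adicCompletion K) δ).toLinearMap).comp
        (absEmbedding (v.adicCompletion K) ((w : HeightOneSpectrum (𝓞 K')).adicCompletion K')).toLinearMap)
      (absEmbedding (v.adicCompletion K) ((w : HeightOneSpectrum (𝓞 K')).adicCompletion K')).toLinearMap
  have hT : ∀ y, y ∈ T ↔
      δ • absEmbedding (v.adicCompletion K) ((w : HeightOneSpectrum (𝓞 K')).adicCompletion K') y =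
        absEmbedding (v.adicCompletion K) ((w : HeightOneSpectrum (𝓞 K')).adicCompletion K') y :=
    fun _ => Iff.rfl
  have hK'T : Set.range (algebraMap K' ((w : HeightOneSpectrum (𝓞 K')).adicCompletion K')) ⊆ T := by
    rintro _ ⟨k, rfl⟩
    rw [SetLike.mem_coe, hT, absEmbedding_place_algebraMap, ← absGaloisRestrict_apply_smul]
    refine congrArg _ ?_
    have hk := h k
    rwa [mul_smul, mul_smul, smul_eq_iff_eq_inv_smul] at hk
  have hTtop : T = ⊤ :=
    top_le_iff.mp ((span_range_algebraMap_place_eq_top v w).ge.trans (Submodule.span_le.mpr hK'T))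
  intro y
  exact (hT y).mp (hTtop ▸ Submodule.mem_top)

/-- **`D'_w = D_v ∩ τ_w⁻¹ H τ_w` is the image of `Γ_{K'_w}`** (membership form): an element `d` of
`D_v` lies in `interConj H D_v τ_w⁻¹` iff it is `res_v (res_{w/v} σ)` for some `σ ∈ Γ_{K'_w}` (`⇐` by
`conjugator_spec`, `⇒` by `mem_range_absGaloisRestrict_place_of_conj_mem`).
[cite: CasselsFrohlichANT1967, Ch. II §10] -/
theorem mem_subgroupOf_interConj_iff (w : Place K K' v)
    (d : (absGaloisRestrict K (v.adicCompletion K)).range) :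
    d ∈ (interConj (absGaloisRestrict K K').range (absGaloisRestrict K (v.adicCompletion K)).range
        (conjugator v w)⁻¹).subgroupOf (absGaloisRestrict K (v.adicCompletion K)).range ↔
      ∃ σ : absoluteGaloisGroup ((w : HeightOneSpectrum (𝓞 K')).adicCompletion K'),
        absGaloisRestrict K (v.adicCompletion K)
          (absGaloisRestrict (v.adicCompletion K) ((w : HeightOneSpectrum (𝓞 K')).adicCompletion K') σ) =
          (d : absoluteGaloisGroup K) := by
  rw [Subgroup.mem_subgroupOf, mem_interConj, inv_inv]
  constructor
  · rintro ⟨-, hd⟩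
    obtain ⟨σ, hσ⟩ := mem_range_absGaloisRestrict_place_of_conj_mem v w
      ((absGaloisRangeEquivCompletion K v).symm d)
      (by rwa [absGaloisRestrict_absGaloisRangeEquivCompletion_symm])
    refine ⟨σ, ?_⟩
    have hσ' : absGaloisRestrict (v.adicCompletion K) ((w : HeightOneSpectrum (𝓞 K')).adicCompletion K') σ =
        (absGaloisRangeEquivCompletion K v).symm d := hσ
    rw [hσ', absGaloisRestrict_absGaloisRangeEquivCompletion_symm]
  · rintro ⟨σ, hσ⟩
    refine ⟨Subtype.coe_prop _, ?_⟩
    rw [← hσ, ← conjugator_spec]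
    exact ⟨_, rfl⟩

/-- **`D'_w ≅ Γ_{K'_w}`**: under `Γ_{K_v} ≅ D_v` (`absGaloisRangeEquivCompletion`), the subgroup
`(interConj H D_v τ_w⁻¹).subgroupOf D_v` is the image of `res_{w/v}(Γ_{K'_w}) ≤ Γ_{K_v}`.
[cite: CasselsFrohlichANT1967, Ch. II §10] -/
theorem subgroupOf_interConj_eq_map_range (w : Place K K' v) :
    (interConj (absGaloisRestrict K K').range (absGaloisRestrict K (v.adicCompletion K)).range
        (conjugator v w)⁻¹).subgroupOf (absGaloisRestrict K (v.adicCompletion K)).range =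
      ((absGaloisRestrict (v.adicCompletion K) ((w : HeightOneSpectrum (𝓞 K')).adicCompletion K')).range).map
        (absGaloisRangeEquivCompletion K v :
          absoluteGaloisGroup (v.adicCompletion K) →* (absGaloisRestrict K (v.adicCompletion K)).range) := by
  ext d
  rw [mem_subgroupOf_interConj_iff, Subgroup.mem_map]
  constructor
  · rintro ⟨σ, hσ⟩
    exact ⟨_, ⟨σ, rfl⟩, Subtype.ext hσ⟩
  · rintro ⟨_, ⟨σ, rfl⟩, rfl⟩
    exact ⟨σ, rfl⟩

/-- **`[D_v : D'_w] = [K'_w : K_v]`** (`D'_w ≅ res_{w/v}(Γ_{K'_w})` has index `[K'_w : K_v]` in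
`Γ_{K_v}`, `index_range_absGaloisRestrict`). [cite: CasselsFrohlichANT1967, Ch. II §10] -/
theorem index_interConj_subgroupOf (w : Place K K' v) :
    ((interConj (absGaloisRestrict K K').range (absGaloisRestrict K (v.adicCompletion K)).range
        (conjugator v w)⁻¹).subgroupOf (absGaloisRestrict K (v.adicCompletion K)).range).index =
      Module.finrank (v.adicCompletion K) ((w : HeightOneSpectrum (𝓞 K')).adicCompletion K') := by
  haveI := LocalField.charZero_adicCompletion v
  haveI := finiteDimensional_place' v w
  rw [subgroupOf_interConj_eq_map_range, ← index_range_absGaloisRestrict (v.adicCompletion K)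
    ((w : HeightOneSpectrum (𝓞 K')).adicCompletion K')]
  exact Subgroup.index_map_of_bijective (EquivLike.bijective (absGaloisRangeEquivCompletion K v)) _

/-! ## hdisj: distinct places give distinct double cosets -/

/-- **Distinct places above `v` give distinct double cosets `D_v τ_w⁻¹ H`**: if
`τ_{w'} (res_v δ) τ_w⁻¹ ∈ H` for some `δ ∈ Γ_{K_v}`, then `δ ∘ e_w` and `e_{w'}` agree on `K'`
(`absEmbedding_place_algebraMap`), so `δ ∘ e_w` maps `K'_w = K_v·K'` into `e_{w'}(K'_{w'})`
(`span_range_algebraMap_place_eq_top`) and `e_{w'}⁻¹ ∘ δ ∘ e_w : K'_w → K'_{w'}` is a `K_v`-algebra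
map over `K'`; by rigidity (`place_eq_of_algHom'`) `w = w'`. [cite: CasselsFrohlichANT1967, Ch. II §10] -/
theorem place_eq_of_conj_mem (w w' : Place K K' v) (δ : absoluteGaloisGroup (v.adicCompletion K))
    (h : conjugator v w' * absGaloisRestrict K (v.adicCompletion K) δ * (conjugator v w)⁻¹ ∈
      (absGaloisRestrict K K').range) :
    w = w' := by
  haveI : FiniteDimensional K K' := Module.Finite.of_restrictScalars_finite ℚ K K'
  haveI := finiteDimensional_place' v w
  haveI := finiteDimensional_place' v w'
  rw [mem_range_absGaloisRestrict_iff_smul_absEmbedding] at h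
  -- (1) `δ • e_w(k') = e_{w'}(k')` for `k' ∈ K'`
  have hk : ∀ k : K',
      δ • absEmbedding (v.adicCompletion K) ((w : HeightOneSpectrum (𝓞 K')).adicCompletion K')
          (algebraMap K' ((w : HeightOneSpectrum (𝓞 K')).adicCompletion K') k) =
        absEmbedding (v.adicCompletion K) ((w' : HeightOneSpectrum (𝓞 K')).adicCompletion K')
          (algebraMap K' ((w' : HeightOneSpectrum (𝓞 K')).adicCompletion K') k) := by
    intro k
    rw [absEmbedding_place_algebraMap, absEmbedding_place_algebraMap, ← absGaloisRestrict_apply_smul]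
    refine congrArg _ ?_
    have hk := h k
    rwa [mul_smul, mul_smul, smul_eq_iff_eq_inv_smul] at hk
  -- (2) `ψ = δ ∘ e_w : K'_w → K̄_v` lands in `e_{w'}(K'_{w'})`
  set e' := absEmbedding (v.adicCompletion K) ((w' : HeightOneSpectrum (𝓞 K')).adicCompletion K') with he'
  set ψ : ((w : HeightOneSpectrum (𝓞 K')).adicCompletion K') →ₐ[v.adicCompletion K]
      AlgebraicClosure (v.adicCompletion K) :=
    ((absoluteGaloisGroup.toAlgEquiv (v.adicCompletion K) δ :
        AlgebraicClosure (v.adicCompletion K) →ₐ[v.adicCompletion K] AlgebraicClosure (v.adicCompletion K))).comp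
      (absEmbedding (v.adicCompletion K) ((w : HeightOneSpectrum (𝓞 K')).adicCompletion K')) with hψ
  have hψ_apply : ∀ y, ψ y =
      δ • absEmbedding (v.adicCompletion K) ((w : HeightOneSpectrum (𝓞 K')).adicCompletion K') y :=
    fun _ => rfl
  have hrange : ∀ y, ψ y ∈ e'.range := by
    let T : Submodule (v.adicCompletion K) ((w : HeightOneSpectrum (𝓞 K')).adicCompletion K') :=
      Submodule.comap ψ.toLinearMap (LinearMap.range e'.toLinearMap)
    have hT : Set.range (algebraMap K' ((w : HeightOneSpectrum (𝓞 K')).adicCompletion K')) ⊆ T := by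
      rintro _ ⟨k, rfl⟩
      refine Submodule.mem_comap.mpr ⟨algebraMap K' ((w' : HeightOneSpectrum (𝓞 K')).adicCompletion K') k, ?_⟩
      rw [AlgHom.toLinearMap_apply, AlgHom.toLinearMap_apply, hψ_apply, hk]
    have hTtop : T = ⊤ :=
      top_le_iff.mp ((span_range_algebraMap_place_eq_top v w).ge.trans (Submodule.span_le.mpr hT))
    intro y
    have hy : y ∈ T := hTtop ▸ Submodule.mem_top
    obtain ⟨z, hz⟩ := Submodule.mem_comap.mp hy
    exact ⟨z, hz⟩
  -- (3) `Θ = e_{w'}⁻¹ ∘ ψ : K'_w → K'_{w'}` is the identity on `K'`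
  set E' := AlgEquiv.ofInjectiveField e' with hE'def
  have hE' : ∀ s : e'.range, e' (E'.symm s) = (s : AlgebraicClosure (v.adicCompletion K)) := fun s => by
    have h1 := AlgEquiv.ofInjective_apply e' e'.toRingHom.injective (E'.symm s)
    rw [← h1]
    change ((E' (E'.symm s) : e'.range) : AlgebraicClosure (v.adicCompletion K)) = s
    rw [AlgEquiv.apply_symm_apply]
  let Θ : ((w : HeightOneSpectrum (𝓞 K')).adicCompletion K') →ₐ[v.adicCompletion K]
      ((w' : HeightOneSpectrum (𝓞 K')).adicCompletion K') :=
    (E'.symm : e'.range →ₐ[v.adicCompletion K] _).comp (ψ.codRestrict e'.range hrange)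
  have hΘ : ∀ k : K', Θ (algebraMap K' ((w : HeightOneSpectrum (𝓞 K')).adicCompletion K') k) =
      algebraMap K' ((w' : HeightOneSpectrum (𝓞 K')).adicCompletion K') k := fun k => by
    apply e'.toRingHom.injective
    change e' (E'.symm (ψ.codRestrict e'.range hrange
      (algebraMap K' ((w : HeightOneSpectrum (𝓞 K')).adicCompletion K') k))) = e' _
    rw [hE']
    change ψ _ = _
    rw [hψ_apply, hk]
  exact place_eq_of_algHom' v Θ hΘ

/-- **hdisj** in the shape of the Mackey formula (`g_w = τ_w⁻¹`): for `d ∈ D_v`,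
`(τ_{w'}⁻¹)⁻¹ d τ_w⁻¹ ∈ H → w = w'`. [cite: NeukirchSchmidtWingberg2008, I §5 (1.5.6)–(1.5.7)] -/
theorem hdisj_place (w w' : Place K K' v) (d : absoluteGaloisGroup K)
    (hd : d ∈ (absGaloisRestrict K (v.adicCompletion K)).range)
    (h : ((conjugator v w')⁻¹)⁻¹ * d * (conjugator v w)⁻¹ ∈ (absGaloisRestrict K K').range) :
    w = w' := by
  obtain ⟨δ, rfl⟩ := hd
  rw [inv_inv] at h
  exact place_eq_of_conj_mem v w w' δ h

/-! ## hcov: the double cosets `D_v τ_w⁻¹ H` cover `Γ_K` (counting) -/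

/-- **hcov** in the shape of the Mackey formula: every `x ∈ Γ_K` lies in some double coset
`D_v τ_w⁻¹ H`, i.e. `(τ_w⁻¹)⁻¹ d⁻¹ x ∈ H` for some `w ∣ v` and `d ∈ D_v`.  Proof by counting: the map
`(w, d D'_w) ↦ d τ_w⁻¹ H`, `Σ_w D_v/D'_w → Γ_K/H`, is injective (`place_eq_of_conj_mem` and the
definition of `D'_w`), and both sides have `Σ_{w∣v} [K'_w : K_v] = [K' : K]` elements
(`index_interConj_subgroupOf`, `sum_finrank_place_eq_finrank`, `index_range_absGaloisRestrict`), so it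
is onto. [cite: CasselsFrohlichANT1967, Ch. II §10] -/
theorem hcov_place (x : absoluteGaloisGroup K) :
    ∃ w : Place K K' v, ∃ d : (absGaloisRestrict K (v.adicCompletion K)).range,
      ((conjugator v w)⁻¹)⁻¹ * (d : absoluteGaloisGroup K)⁻¹ * x ∈ (absGaloisRestrict K K').range := by
  haveI : FiniteDimensional K K' := Module.Finite.of_restrictScalars_finite ℚ K K'
  set H := (absGaloisRestrict K K').range with hH
  set Dv := (absGaloisRestrict K (v.adicCompletion K)).range with hDv
  set D' : Place K K' v → Subgroup (absoluteGaloisGroup K) :=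
    fun w => interConj H Dv (conjugator v w)⁻¹ with hD'
  -- finiteness
  haveI hHfin : H.FiniteIndex :=
    ⟨by rw [hH, index_range_absGaloisRestrict]; exact Module.finrank_pos.ne'⟩
  haveI hD'fin : ∀ w, ((D' w).subgroupOf Dv).FiniteIndex := fun w =>
    ⟨by
      haveI := finiteDimensional_place' v w
      rw [hD', hH, hDv, index_interConj_subgroupOf]; exact Module.finrank_pos.ne'⟩
  -- the map `(w, d D'_w) ↦ d τ_w⁻¹ H`
  let f : (Σ w : Place K K' v, Dv ⧸ (D' w).subgroupOf Dv) → absoluteGaloisGroup K ⧸ H :=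
    fun q => ↑(((Quotient.out q.2 : Dv) : absoluteGaloisGroup K) * (conjugator v q.1)⁻¹)
  have hf : ∀ q : Σ w : Place K K' v, Dv ⧸ (D' w).subgroupOf Dv,
      f q = ↑(((Quotient.out q.2 : Dv) : absoluteGaloisGroup K) * (conjugator v q.1)⁻¹) := fun _ => rfl
  have hf_inj : Function.Injective f := by
    rintro ⟨w₁, q₁⟩ ⟨w₂, q₂⟩ hq
    rw [hf, hf] at hq
    have h12 := QuotientGroup.eq.mp hq
    have h12' : conjugator v w₁ *
        ((((Quotient.out q₁ : Dv) : absoluteGaloisGroup K))⁻¹ * ((Quotient.out q₂ : Dv) : absoluteGaloisGroup K)) *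
        (conjugator v w₂)⁻¹ ∈ H := by
      have e : conjugator v w₁ *
          ((((Quotient.out q₁ : Dv) : absoluteGaloisGroup K))⁻¹ * ((Quotient.out q₂ : Dv) : absoluteGaloisGroup K)) *
          (conjugator v w₂)⁻¹ =
          ((((Quotient.out q₁ : Dv) : absoluteGaloisGroup K) * (conjugator v w₁)⁻¹))⁻¹ *
            (((Quotient.out q₂ : Dv) : absoluteGaloisGroup K) * (conjugator v w₂)⁻¹) := by group
      rwa [e]
    -- the places agree
    obtain ⟨δ, hδ⟩ : (((Quotient.out q₁ : Dv) : absoluteGaloisGroup K))⁻¹ *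
        ((Quotient.out q₂ : Dv) : absoluteGaloisGroup K) ∈ Dv :=
      Dv.mul_mem (Dv.inv_mem (Quotient.out q₁).2) (Quotient.out q₂).2
    have hδ' : absGaloisRestrict K (v.adicCompletion K) δ = _ := hδ
    have hw : w₂ = w₁ := place_eq_of_conj_mem v w₂ w₁ δ (by rw [hδ']; exact h12')
    subst hw
    -- then the cosets agree
    have hD'mem : (Quotient.out q₁ : Dv)⁻¹ * Quotient.out q₂ ∈ (D' w₂).subgroupOf Dv := by
      rw [Subgroup.mem_subgroupOf]
      change (((Quotient.out q₁ : Dv)⁻¹ * Quotient.out q₂ : Dv) : absoluteGaloisGroup K) ∈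
        interConj H Dv (conjugator v w₂)⁻¹
      rw [mem_interConj, inv_inv, Subgroup.coe_mul, Subgroup.coe_inv]
      exact ⟨Dv.mul_mem (Dv.inv_mem (Quotient.out q₁).2) (Quotient.out q₂).2, h12'⟩
    have hq' : q₁ = q₂ := by
      rw [← QuotientGroup.out_eq' q₁, ← QuotientGroup.out_eq' q₂]
      exact QuotientGroup.eq.mpr hD'mem
    subst hq'
    rfl
  -- cardinalities: `#(Γ_K/H) = [K' : K] = Σ_w [K'_w : K_v] = #(Σ_w D_v/D'_w)`
  have hcard : Nat.card (absoluteGaloisGroup K ⧸ H) ≤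
      Nat.card (Σ w : Place K K' v, Dv ⧸ (D' w).subgroupOf Dv) := by
    haveI : ∀ w, Fintype (Dv ⧸ (D' w).subgroupOf Dv) := fun w => Fintype.ofFinite _
    rw [Nat.card_eq_fintype_card (α := Σ w : Place K K' v, Dv ⧸ (D' w).subgroupOf Dv),
      Fintype.card_sigma, ← Subgroup.index_eq_card, hH, index_range_absGaloisRestrict,
      ← sum_finrank_place_eq_finrank v]
    refine (Finset.sum_congr rfl fun w _ => ?_).le
    rw [← Nat.card_eq_fintype_card, ← Subgroup.index_eq_card]
    exact (index_interConj_subgroupOf v w).symm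
  obtain ⟨⟨w, q⟩, hwq⟩ := (hf_inj.bijective_of_nat_card_le hcard).2 (x : absoluteGaloisGroup K ⧸ H)
  refine ⟨w, Quotient.out q, ?_⟩
  rw [hf] at hwq
  have hx := QuotientGroup.eq.mp hwq
  rwa [mul_inv_rev] at hx

end Dictionary

end Summit.BirchSwinnertonDyer.BirchSwinnertonDyer.Theorems.KolyvaginRoadThreePT

end
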